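import Literature.Geometry.Lorentzian.ReggeWheelerChannels

/-!
# drefute mutation witness for Stub 3 (`stub_nearKernelCensus`) of line `kruskal-rest-frame-virial`

Dropping the tortoise hypothesis `IsTortoiseRadius M r xc` (equivalently: the exponential decay of
`V = V_{s,ℓ}∘r` at the horizon end) makes the near-side kernel census FALSE: for the constant radius
`r ≡ 3` (`M = 1`) the potential is the constant `V ≡ 2/27`, and `p(t,x) = t·e^{kx}`, `k = √(2/27)`,
is a `t`-polynomial kernel element with FINITE near energy `∫_{x<0} e^{2kx} dx = 1/(2k)` whose velocity
trace `e^{kx}` does not vanish.  So any proof of Stub 3 must use the horizon decay of `V`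
(as the landed census `KernelCensus.static_of_finite_energy` does through `V ≤ C e^{κx}`).
-/

open Literature.Geometry.Lorentzian.ReggeWheeler MeasureTheory Set
open scoped ENNReal

namespace DrefuteMutation

/-- Stub 3 of `Lines/kruskal-rest-frame-virial.lean` (lead's reshape 2026-08-16) with the hypothesis
`IsTortoiseRadius M r xc` dropped. -/
def NearKernelCensusWithoutTortoise : Prop :=
  ∀ (M : ℝ) (r : ℝ → ℝ) (xc : ℝ) (s ℓ : ℕ), s ≤ ℓ → ∀ (ρ : ℝ) (p : ℝ → ℝ → ℝ),
    p ∈ rwKernel (linePotential M s ℓ r) xc ρ →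
    (∫⁻ x in Iio (xc - ρ), ENNReal.ofReal (energyDensity (linePotential M s ℓ r) p 0 x) < ∞) →
    ∀ x, x < xc - ρ → deriv (fun τ => p τ x) 0 = 0

theorem not_nearKernelCensusWithoutTortoise : ¬ NearKernelCensusWithoutTortoise := by
  intro h
  set k : ℝ := Real.sqrt (2 / 27) with hk
  have hk2 : k * k = 2 / 27 := by rw [hk, Real.mul_self_sqrt]; norm_num
  have hkpos : 0 < k := by rw [hk]; positivity
  set V : ℝ → ℝ := linePotential 1 1 1 (fun _ => (3 : ℝ)) with hVdef
  -- constant radius 3 (M = 1): the potential is the constant 2/27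
  have hV : ∀ x, V x = 2 / 27 := by
    intro x; simp only [hVdef, linePotential, rwPotential]; norm_num
  set S : ℝ → ℝ := fun x => Real.exp (k * x) with hS
  have hSd : ∀ x, HasDerivAt S (k * Real.exp (k * x)) x := fun x => by
    have h1 : HasDerivAt (fun y : ℝ => k * y) k x := by
      simpa using (hasDerivAt_id x).const_mul k
    have h2 := h1.exp
    simpa [hS, mul_comm] using h2
  have hS' : deriv S = fun x => k * Real.exp (k * x) := funext fun x => (hSd x).deriv
  have hS2 : ∀ x, iteratedDeriv 2 S x = V x * S x := by
    intro x
    rw [iteratedDeriv_succ, iteratedDeriv_one, hS', hV]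
    have h3 : HasDerivAt (fun y => k * Real.exp (k * y)) (k * (k * Real.exp (k * x))) x :=
      (hSd x).const_mul k
    rw [h3.deriv, hS, ← mul_assoc, hk2]
  have hSC : ContDiff ℝ 2 S := by
    have : ContDiff ℝ 2 (fun x : ℝ => k * x) := contDiff_const.mul contDiff_id
    exact this.exp
  have hp : (fun (t x : ℝ) => t * S x) ∈ rwKernel V 0 0 := mul_mem_rwKernel hSC hS2 0 0
  -- the energy density of `p` at `t = 0` is `e^{2kx}`
  have henergy : ∀ x, energyDensity V (fun t x => t * S x) 0 x = Real.exp ((2 * k) * x) := by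
    intro x
    unfold energyDensity
    have h1 : deriv (fun τ : ℝ => τ * S x) 0 = S x := by
      have : HasDerivAt (fun τ : ℝ => τ * S x) (1 * S x) 0 := (hasDerivAt_id (0:ℝ)).mul_const _
      rw [this.deriv, one_mul]
    have h2 : (fun t x => t * S x) 0 = fun _ => (0 : ℝ) := by funext y; simp
    rw [h1, h2]
    simp only [deriv_const', hS]
    rw [show Real.exp (k * x) ^ 2 = Real.exp (k * x) * Real.exp (k * x) from sq _, ← Real.exp_add]
    ring_nf
  -- finite near energy on `(-∞, 0)`
  have hfin : ∫⁻ x in Iio ((0 : ℝ) - 0), ENNReal.ofReal (energyDensity V (fun t x => t * S x) 0 x) < ∞ := by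
    rw [sub_zero]
    have hint : IntegrableOn (fun x : ℝ => Real.exp ((2 * k) * x)) (Iio 0) :=
      (integrableOn_exp_mul_Iic (by positivity : 0 < 2 * k) 0).mono_set Iio_subset_Iic_self
    have := hint.lintegral_lt_top
    refine lt_of_le_of_lt (le_of_eq ?_) this
    refine lintegral_congr_ae (ae_of_all _ fun x => ?_)
    show ENNReal.ofReal _ = ENNReal.ofReal _
    rw [henergy]
  -- the census would force the velocity trace `e^{kx}` to vanish at `x = -1`
  have h0 := h 1 (fun _ => (3 : ℝ)) 0 1 1 le_rfl 0 (fun t x => t * S x) hp hfin (-1) (by norm_num)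
  have h1 : deriv (fun τ : ℝ => τ * S (-1)) 0 = S (-1) := by
    have : HasDerivAt (fun τ : ℝ => τ * S (-1)) (1 * S (-1)) 0 := (hasDerivAt_id (0:ℝ)).mul_const _
    rw [this.deriv, one_mul]
  have h2 : S (-1) = 0 := by rw [← h1]; exact h0
  exact (Real.exp_pos _).ne' h2

end DrefuteMutation
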